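import Literature.AnabelianGeometry.SemiGraphs.CoveringGraphVertexFibres
import Literature.AnabelianGeometry.SemiGraphs.SpecialFibreTowerOfTemperedPi
import HarnessLib

/-!
# [SemiAnbd] Example 3.10: the vertices of the fibres `𝒢_i` of the special-fibre tower over `π₁^temp(𝒢)`,
# and the action of `Δ = π₁^temp(𝒢)` on them through `Δ/N_i` — fibre-transitive over `𝒢`

Mochizuki, *Semi-graphs of anabelioids*, Publ. RIMS **42** (2006), §3, Example 3.10, manuscript p. 44 l. 9–17
[cite: MochizukiSemiAnbd2006, Ex 3.10 p.44] ("`N_i` determines a finite étale covering … [whose special fiber]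
gives rise to semi-graphs of anabelioids `𝒢_i`, `𝒢^c_i` on which `Δ_i` acts faithfully"), with Theorem 3.7
(i)/(ii) p. 40 and Remark 2.2.1 p. 24; S. Mochizuki, *Inter-universal Teichmüller theory I*, proof of Prop. 2.4
(i) p. 50 l. 27–30 (the action of `Π^tp_X` on the special fibre of `X_J` through `Π^tp_X/J`)
[cite: Mochizuki2012, Prop 2.4(i) p.50].

PROOF-ONLY file (abc-iut cell, layer L3, seat abc-iut-L3-t2 gen 5, row «Ex310-VERTEX-FIBRES», owner lineage of the
[SemiAnbd] §3 interface; no definition, no instance, no new named fact).  Sequel of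
`SpecialFibreTowerOfCoverings.lean` (`SpecialFibreTower.exists_of_coverings`: the Ex. 3.10 tower EXISTS over
`π₁^temp(𝒢)` with fibres the covering semi-graphs of anabelioids `𝒢_{S_i}` of the levels `N_i`) and of
`CoveringGraphVertexFibres.lean` (vertices of `𝒢_S` over `v` ↔ classes of verticial subgroups at `v` modulo the open
stabiliser).  The construction is re-run keeping the route-T identification `N_i = Stab ⥲ π₁^temp(𝒢_{S_i})` in hand,
and the tower is delivered TOGETHER WITH the vertex-level structure of its fibres
(`SpecialFibreTower.exists_of_coverings_vertexFibres`), for every level `i`, with `proj : 𝔾_i → 𝔾` the vertex map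
of the covering `𝒢_{S_i} → 𝒢`:
* (V0) `proj` is surjective;
* (V1)/(V2) the verticial subgroups of `π₁^temp(𝒢_i)` at a vertex `ṽ` are EXACTLY the images, under the admissible
  quotient `N_i ⥲ π₁^temp(𝒢_i)`, of the traces `N_i ∩ K` of the verticial subgroups `K` of `π₁^temp(𝒢)` at
  `proj ṽ`;
* (V3) every verticial `K` at `v` has its trace verticial at EXACTLY ONE vertex of `𝔾_i`, lying over `v`;
* (V4) two verticial `K, K′` at `v` have their traces verticial at the same vertex iff `K′ = nKn⁻¹`, `n ∈ N_i` —
  so **the vertices of `𝔾_i` over `v` are the `N_i`-conjugacy classes of the verticial subgroups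
  `π̂₁(𝒢_v) ↪ π₁^temp(𝒢)`** (Rmk. 2.2.1);
* (V5) for `g ∈ Δ = π₁^temp(𝒢)` and a vertex `ṽ` there is a UNIQUE vertex `g · ṽ` over `proj ṽ` such that
  conjugation by `g` carries the class of `ṽ` to the class of `g · ṽ`; `Δ` is TRANSITIVE on every fibre
  `proj⁻¹(v)`, and (V4) `N_i` acts trivially — "`Δ_i = Δ/N_i` acts on `𝒢_i`" with quotient `𝒢`, at the level of
  vertices, as a THEOREM at the genuine fibres (the vertex part of the origin datum `SpecialFibreTower.PiData`,
  item (P2), previously witnessed only at one-vertex fibres with trivial actions).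
HONEST LIMITS: vertices only (edges of `𝔾_i`, in particular open ones, are not treated here); strict coherence
assumed (automatic for finite coherent `𝒢`); nothing here is about curves; no side is taken on [IUTchIII]
Cor. 3.12.
-/

noncomputable section

open CategoryTheory Topology

namespace Literature.AnabelianGeometry.SemiGraphs

open Literature.AlgebraicGeometry.Frobenioids (IsSlimGroup IsConnectedObj)
open Literature.AlgebraicGeometry.Frobenioids.QuasiTemperoid.BTempConnected
  (hom_ρ ρ_one_apply ρ_mul_apply isConnectedObj_of_transitive)
open ProfiniteSemiGraph

universe u

/-! ### Helpers -/

/-- Transport of the étale identification `φ : U ⥲ π₁^temp(𝒢_S)` along `U = N`, remembering its effect on traces.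
[folklore] -/
private theorem exists_adm_of_eq' {G H : Type u} [Group G] [TopologicalSpace G] [Group H] [TopologicalSpace H]
    {U N : Subgroup G} (h : U = N) (φ : U →ₜ* H) (hs : Function.Surjective φ) (ho : IsOpenMap φ)
    (hk : φ.toMonoidHom.ker = ⊥) :
    ∃ ψ : N →ₜ* H, Function.Surjective ψ ∧ IsOpenMap ψ ∧ ψ.toMonoidHom.ker = ⊥ ∧
      ∀ K : Subgroup G, (K.subgroupOf N).map ψ.toMonoidHom = (K.subgroupOf U).map φ.toMonoidHom := by
  subst h
  exact ⟨φ, hs, ho, hk, fun _ => rfl⟩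

/-- `g (n K n⁻¹) g⁻¹ = (g n g⁻¹) (g K g⁻¹) (g n g⁻¹)⁻¹`. [folklore] -/
private theorem subgroup_map_conj_conj_swap {G : Type u} [Group G] (K : Subgroup G) (g n : G) :
    (K.map (MulAut.conj n).toMonoidHom).map (MulAut.conj g).toMonoidHom =
      (K.map (MulAut.conj g).toMonoidHom).map (MulAut.conj (g * n * g⁻¹)).toMonoidHom := by
  rw [Subgroup.map_map, Subgroup.map_map]
  congr 1
  ext x
  simp only [MonoidHom.coe_comp, MulEquiv.coe_toMonoidHom, Function.comp_apply, MulAut.conj_apply]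
  group

/-- A subgroup is verticial at no two distinct vertices (Thm. 3.7 (ii): verticial subgroups at distinct vertices
meet with infinite index). [cite: MochizukiSemiAnbd2006, Thm 3.7(ii) p.40] -/
private theorem vertex_eq_of_mem_verticialSubgroups_twice {ℋ : ProfiniteSemiGraph.{u}} (h37 : ℋ.Thm37Hypotheses)
    (cH : TemperedPiChart ℋ) {w₁ w₂ : ℋ.graph.Vertex} {H : Subgroup cH.G}
    (h₁ : H ∈ verticialSubgroups cH w₁) (h₂ : H ∈ verticialSubgroups cH w₂) : w₁ = w₂ := by
  by_contra hne
  have h0 := (verticialDistinct_holds ℋ h37 cH).1 _ _ _ _ h₁ h₂ hne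
  rw [Subgroup.relIndex_self] at h0
  exact one_ne_zero h0

/-! ### The tower with the vertex structure of its fibres -/

namespace SpecialFibreTower

variable {𝒢 : ProfiniteSemiGraph.{u}}

/-- **[SemiAnbd] Example 3.10 — the special-fibre tower over `π₁^temp(𝒢)` together with the VERTEX STRUCTURE of its
fibres and the action of `Δ = π₁^temp(𝒢)` on their vertices.**  For `𝒢` with the hypotheses of Thm. 3.7 and
strictly coherent, a chart `c`, and every antitone exhaustive sequence `N` of open characteristic normal finite-index
subgroups: a `SpecialFibreTower c.G` with `T.N = N`, `T.admKer i = 1`, fibres `T.Gc i = 𝒢_{S_i}` (covering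
semi-graphs of anabelioids of connected tempered `S_i`), and for every `i` the vertex map `proj : 𝔾_i → 𝔾` with:
(V0) `proj` surjective; (V1) every vertex `ṽ` carries, as a verticial subgroup of `π₁^temp(𝒢_i)`, the image under
`T.adm i` of a trace `N_i ∩ K`, `K` verticial at `proj ṽ`; (V2) every verticial subgroup at `ṽ` is such an image;
(V3) every verticial `K` at `v` has its trace verticial at exactly one vertex, which lies over `v`; (V4) for `K, K′`
verticial at `v` with the trace of `K` verticial at `ṽ`: the trace of `K′` is verticial at `ṽ` iff `K′ = nKn⁻¹` for
some `n ∈ N_i`; (V5) for `g ∈ Δ` and `ṽ` a unique vertex `w̃` over `proj ṽ` receives the `g`-conjugates of the class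
of `ṽ`, and `Δ` is transitive on each fibre of `proj`.  [cite: MochizukiSemiAnbd2006, Ex 3.10 p.44] -/
theorem exists_of_coverings_vertexFibres (h37 : 𝒢.Thm37Hypotheses) (hsc : 𝒢.IsStrictlyCoherent)
    (c : TemperedPiChart 𝒢) (N : ℕ → Subgroup c.G) (hanti : Antitone N) (hopen : ∀ i, IsOpen (N i : Set c.G))
    (hchar : ∀ (i) (φ : c.G ≃ₜ* c.G), (N i).map φ.toMulEquiv.toMonoidHom = N i)
    (hnormal : ∀ i, (N i).Normal) (hfi : ∀ i, (N i).FiniteIndex) (hexh : ∀ g : c.G, (∀ i, g ∈ N i) → g = 1) :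
    ∃ T : SpecialFibreTower c.G, T.N = N ∧ (∀ i, T.admKer i = ⊥) ∧
      ∀ i, ∃ (S : CovObj 𝒢) (hS : S.IsTempered) (_ : T.Gc i = S.coveringGraph)
        (proj : (T.Gc i).graph.Vertex → 𝒢.graph.Vertex),
        IsConnectedObj (⟨S, hS⟩ : BTempCat 𝒢) ∧
        -- (V0)
        Function.Surjective proj ∧
        -- (V1)
        (∀ x, ∃ K ∈ verticialSubgroups c (proj x),
          (K.subgroupOf (T.N i)).map (T.adm i).toMonoidHom ∈ verticialSubgroups (T.chart i) x) ∧
        -- (V2)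
        (∀ x (H : Subgroup (T.chart i).G), H ∈ verticialSubgroups (T.chart i) x →
          ∃ K ∈ verticialSubgroups c (proj x), H = (K.subgroupOf (T.N i)).map (T.adm i).toMonoidHom) ∧
        -- (V3)
        (∀ (v : 𝒢.graph.Vertex) (K : Subgroup c.G), K ∈ verticialSubgroups c v →
          (∃! x, (K.subgroupOf (T.N i)).map (T.adm i).toMonoidHom ∈ verticialSubgroups (T.chart i) x) ∧
          ∀ x, (K.subgroupOf (T.N i)).map (T.adm i).toMonoidHom ∈ verticialSubgroups (T.chart i) x →
            proj x = v) ∧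
        -- (V4)
        (∀ (v : 𝒢.graph.Vertex) x (K K' : Subgroup c.G), K ∈ verticialSubgroups c v →
          K' ∈ verticialSubgroups c v →
          (K.subgroupOf (T.N i)).map (T.adm i).toMonoidHom ∈ verticialSubgroups (T.chart i) x →
          ((K'.subgroupOf (T.N i)).map (T.adm i).toMonoidHom ∈ verticialSubgroups (T.chart i) x ↔
            ∃ n ∈ T.N i, K' = K.map (MulAut.conj n).toMonoidHom)) ∧
        -- (V5) existence and uniqueness of `g · x`
        (∀ (g : c.G) x, ∃! w, proj w = proj x ∧ ∀ K ∈ verticialSubgroups c (proj x),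
          (K.subgroupOf (T.N i)).map (T.adm i).toMonoidHom ∈ verticialSubgroups (T.chart i) x →
          ((K.map (MulAut.conj g).toMonoidHom).subgroupOf (T.N i)).map (T.adm i).toMonoidHom ∈
            verticialSubgroups (T.chart i) w) ∧
        -- (V5) transitivity on the fibres of `proj`
        (∀ x₁ x₂, proj x₁ = proj x₂ → ∃ g : c.G, ∀ K ∈ verticialSubgroups c (proj x₁),
          (K.subgroupOf (T.N i)).map (T.adm i).toMonoidHom ∈ verticialSubgroups (T.chart i) x₁ →
          ((K.map (MulAut.conj g).toMonoidHom).subgroupOf (T.N i)).map (T.adm i).toMonoidHom ∈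
            verticialSubgroups (T.chart i) x₂) := by
  classical
  haveI := c.secondCountableTopology
  haveI := c.isTopologicalGroup
  have h36 : 𝒢.Prop36Hypotheses := h37.toProp36Hypotheses
  have hcoh : 𝒢.IsCoherent := hsc.isCoherent
  have hslim : IsSlimGroup c.G := temperedPiSlim_holds 𝒢 h36 c
  -- the objects `π₁^temp(𝒢)/N_i` of `B^temp(π₁^temp(𝒢))`: connected (transitive)
  let Q : ℕ → BTemp c.G := fun i =>
    ⟨Action.ofMulAction c.G (c.G ⧸ N i), (temperedAction_quotient_iff c.isTempered (N i)).mpr (hopen i)⟩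
  have hQconn : ∀ i, IsConnectedObj (Q i) := fun i => by
    refine isConnectedObj_of_transitive (Q i) (QuotientGroup.mk 1 : c.G ⧸ N i) fun x => ?_
    induction x using QuotientGroup.induction_on with
    | H z =>
      refine ⟨z, ?_⟩
      change z • (QuotientGroup.mk 1 : c.G ⧸ N i) = QuotientGroup.mk z
      rw [MulAction.Quotient.smul_mk, smul_eq_mul, mul_one]
  -- the connected tempered coverings `S_i`, their covering graphs, charts, étale identifications
  have key : ∀ i, ∃ (S : CovObj 𝒢) (hS : S.IsTempered) (hSc : IsConnectedObj (⟨S, hS⟩ : BTempCat 𝒢))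
      (_ : Nonempty (c.equiv.functor.obj ⟨S, hS⟩ ≅ Q i)) (cS : TemperedPiChart S.coveringGraph)
      (ω₀ : BTemp.Orbits (c.equiv.functor.obj ⟨S, hS⟩))
      (φ : BTemp.stab (c.equiv.functor.obj ⟨S, hS⟩) (Quot.out ω₀) →ₜ* cS.G),
      Nonempty (cS.equiv.inverse ⋙ (S.etaleEquiv uniformSplitting_holds h36 hcoh hS).functor ⋙
          (Over.postEquiv (⟨S, hS⟩ : BTempCat 𝒢) c.equiv).functor ⋙
          BTemp.fibreFamily (c.equiv.functor.obj ⟨S, hS⟩) ⋙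
          Pi.eval (fun ω => BTemp (BTemp.stab (c.equiv.functor.obj ⟨S, hS⟩) (Quot.out ω))) ω₀ ≅
        BTemp.res φ) ∧
      Function.Bijective φ ∧ IsOpenMap φ ∧
      BTemp.stab (c.equiv.functor.obj ⟨S, hS⟩) (Quot.out ω₀) = N i := by
    intro i
    let Sobj : BTempCat 𝒢 := c.equiv.inverse.obj (Q i)
    have hSc : IsConnectedObj Sobj := TemperoidTransport.isConnectedObj_functor_obj c.equiv.symm (hQconn i)
    let S : CovObj 𝒢 := Sobj.obj
    have hS : S.IsTempered := Sobj.property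
    have hSc' : IsConnectedObj (⟨S, hS⟩ : BTempCat 𝒢) := hSc
    let iso : c.equiv.functor.obj ⟨S, hS⟩ ≅ Q i := c.equiv.counitIso.app (Q i)
    have h37' : S.coveringGraph.Thm37Hypotheses := S.thm37Hypotheses_coveringGraph h37 hsc hS hSc'
    let cS : TemperedPiChart S.coveringGraph := S.coveringGraph.temperedPiChart h37'.toProp36Hypotheses
    let x₀ : (c.equiv.functor.obj ⟨S, hS⟩).obj.V := iso.inv.hom.hom (QuotientGroup.mk 1 : c.G ⧸ N i)
    let ω₀ : BTemp.Orbits (c.equiv.functor.obj ⟨S, hS⟩) := BTemp.cl _ x₀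
    obtain ⟨φ, ψ, hψφ, hφψ, hcompat⟩ := CovObj.exists_chartGroup_compatIso h36 hcoh c S hS hSc' cS ω₀
    have hUN : BTemp.stab (c.equiv.functor.obj ⟨S, hS⟩) (Quot.out ω₀) = N i := by
      ext g
      rw [BTemp.mem_stab_iff_of_iso iso]
      haveI := hnormal i
      rw [BTemp.stab_quotient_eq c.isTempered (N i) (hopen i)]
    have hbij : Function.Bijective φ :=
      ⟨Function.LeftInverse.injective hψφ, fun y => ⟨ψ y, hφψ y⟩⟩
    have hopenφ : IsOpenMap φ := by
      let e : ↥(BTemp.stab (c.equiv.functor.obj ⟨S, hS⟩) (Quot.out ω₀)) ≃ₜ cS.G :=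
        { toFun := φ, invFun := ψ, left_inv := hψφ, right_inv := hφψ,
          continuous_toFun := φ.continuous, continuous_invFun := ψ.continuous }
      exact e.isOpenMap
    exact ⟨S, hS, hSc', ⟨iso⟩, cS, ω₀, φ, hcompat, hbij, hopenφ, hUN⟩
  choose S hS hSc hiso cS ω₀ φ hφ hφb hφo hUN using key
  -- the admissible quotients `N_i ⥲ π₁^temp(𝒢_{S_i})` and their effect on traces
  have hadm : ∀ i, ∃ ψ : N i →ₜ* (cS i).G, Function.Surjective ψ ∧ IsOpenMap ψ ∧ ψ.toMonoidHom.ker = ⊥ ∧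
      ∀ K : Subgroup c.G, (K.subgroupOf (N i)).map ψ.toMonoidHom =
        (K.subgroupOf (BTemp.stab (c.equiv.functor.obj ⟨S i, hS i⟩) (Quot.out (ω₀ i)))).map
          (φ i).toMonoidHom := fun i =>
    exists_adm_of_eq' (hUN i) (φ i) (hφb i).2 (hφo i) ((MonoidHom.ker_eq_bot_iff _).mpr (hφb i).1)
  choose adm hsurj hopenMap hker hadmK using hadm
  refine ⟨{ N := N
            N_antitone := hanti
            isOpen_N := hopen
            N_char := hchar
            N_normal := hnormal
            N_finiteIndex := hfi
            N_exhaustive := hexh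
            Gc := fun i => (S i).coveringGraph
            hyp := fun i => (S i).thm37Hypotheses_coveringGraph h37 hsc (hS i) (hSc i)
            chart := fun i => cS i
            admKer := fun _ => ⊥
            admKer_le := fun _ => bot_le
            admKer_normal := fun _ => inferInstance
            admKer_antitone := fun _ _ _ => le_rfl
            adm := adm
            adm_surjective := hsurj
            isOpenMap_adm := hopenMap
            ker_adm := fun i => by rw [hker i, Subgroup.bot_subgroupOf]
            faithful := fun i g hg => ?_ }, rfl, fun _ => rfl, fun i => ?_⟩
  · -- an element centralising the open `N_i` is trivial (temp-slimness, Prop. 3.6 (iv)), so lies in `N_i`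
    have hz : g ∈ Subgroup.centralizer (N i : Set c.G) := by
      rw [Subgroup.mem_centralizer_iff]
      intro n hn
      have h := hg n hn
      rw [Subgroup.mem_bot] at h
      have : g * n = n * g := by
        calc g * n = g * n * g⁻¹ * n⁻¹ * (n * g) := by group
          _ = n * g := by rw [h, one_mul]
      exact this.symm
    rw [hslim.centralizer_eq_bot _ (hopen i), Subgroup.mem_bot] at hz
    rw [hz]; exact (N i).one_mem
  · -- the vertex structure of the fibre `𝒢_{S_i}`
    have h37S : (S i).coveringGraph.Thm37Hypotheses := (S i).thm37Hypotheses_coveringGraph h37 hsc (hS i) (hSc i)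
    -- shorthand for the Part-A lemmas at level `i`
    have hV1 : ∀ (v : 𝒢.graph.Vertex) (ω : BTemp.Orbits ((S i).SV v)), ∃ K ∈ verticialSubgroups c v,
        (K.subgroupOf (N i)).map (adm i).toMonoidHom ∈
          verticialSubgroups (cS i) (⟨v, ω⟩ : (S i).coveringGraph.graph.Vertex) := fun v ω => by
      obtain ⟨K, hK, hmem⟩ := (S i).exists_trace_mem_verticialSubgroups h36 hcoh c (hS i) (hSc i) (cS i)
        (ω₀ i) (φ i) (hφ i) v ω
      exact ⟨K, hK, by rw [hadmK]; exact hmem⟩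
    have hV2 : ∀ (v : 𝒢.graph.Vertex) (ω : BTemp.Orbits ((S i).SV v)) (H : Subgroup (cS i).G),
        H ∈ verticialSubgroups (cS i) (⟨v, ω⟩ : (S i).coveringGraph.graph.Vertex) →
        ∃ K ∈ verticialSubgroups c v, H = (K.subgroupOf (N i)).map (adm i).toMonoidHom := fun v ω H hH => by
      obtain ⟨K, hK, hHK⟩ := (S i).exists_trace_eq_of_mem_verticialSubgroups h36 hcoh c (hS i) (hSc i) (cS i)
        (ω₀ i) (φ i) (hφ i) (hφb i) v ω hH
      exact ⟨K, hK, by rw [hadmK]; exact hHK⟩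
    have hfst : ∀ {v v' : 𝒢.graph.Vertex} {ω' : BTemp.Orbits ((S i).SV v')} {K : Subgroup c.G},
        K ∈ verticialSubgroups c v →
        (K.subgroupOf (N i)).map (adm i).toMonoidHom ∈
          verticialSubgroups (cS i) (⟨v', ω'⟩ : (S i).coveringGraph.graph.Vertex) → v' = v :=
      fun {v v' ω' K} hK h => by
      rw [hadmK] at h
      exact (S i).fst_eq_of_trace_mem_verticialSubgroups h36 hcoh c (hS i) (hSc i) (cS i) (ω₀ i) (φ i) (hφ i)
        h37 (hφb i) hK h
    have hV3 : ∀ (v : 𝒢.graph.Vertex) {K : Subgroup c.G}, K ∈ verticialSubgroups c v →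
        ∃! ω : BTemp.Orbits ((S i).SV v), (K.subgroupOf (N i)).map (adm i).toMonoidHom ∈
          verticialSubgroups (cS i) (⟨v, ω⟩ : (S i).coveringGraph.graph.Vertex) := fun v K hK => by
      have h := (S i).existsUnique_orbit_trace_mem_verticialSubgroups h36 hcoh c (hS i) (hSc i) (cS i) (ω₀ i)
        (φ i) (hφ i) h37 hsc v hK
      rw [hadmK]; exact h
    have hsame : ∀ {v : 𝒢.graph.Vertex} {ω : BTemp.Orbits ((S i).SV v)} {K : Subgroup c.G} (n : c.G),
        n ∈ N i → (K.subgroupOf (N i)).map (adm i).toMonoidHom ∈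
          verticialSubgroups (cS i) (⟨v, ω⟩ : (S i).coveringGraph.graph.Vertex) →
        ((K.map (MulAut.conj n).toMonoidHom).subgroupOf (N i)).map (adm i).toMonoidHom ∈
          verticialSubgroups (cS i) (⟨v, ω⟩ : (S i).coveringGraph.graph.Vertex) := fun {v ω K} n hn h => by
      rw [hadmK] at h ⊢
      have hn' : n ∈ BTemp.stab (c.equiv.functor.obj ⟨S i, hS i⟩) (Quot.out (ω₀ i)) := by rw [hUN i]; exact hn
      exact (S i).traces_same_vertex_of_mem_stab c (hS i) (cS i) (ω₀ i) (φ i) h ⟨n, hn'⟩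
    have hconj : ∀ {v : 𝒢.graph.Vertex} {ω : BTemp.Orbits ((S i).SV v)} {K K' : Subgroup c.G},
        K ∈ verticialSubgroups c v → K' ∈ verticialSubgroups c v →
        (K.subgroupOf (N i)).map (adm i).toMonoidHom ∈
          verticialSubgroups (cS i) (⟨v, ω⟩ : (S i).coveringGraph.graph.Vertex) →
        (K'.subgroupOf (N i)).map (adm i).toMonoidHom ∈
          verticialSubgroups (cS i) (⟨v, ω⟩ : (S i).coveringGraph.graph.Vertex) →
        ∃ n ∈ N i, K' = K.map (MulAut.conj n).toMonoidHom := fun {v ω K K'} hK hK' h h' => by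
      rw [hadmK] at h h'
      obtain ⟨u, hu⟩ := (S i).exists_mem_stab_conj_eq_of_traces_same_vertex c (hS i) (cS i) (ω₀ i) (φ i) h37
        (hφb i) hK hK' h h'
      exact ⟨(u : c.G), (hUN i).le u.2, hu⟩
    refine ⟨S i, hS i, rfl, fun x => x.1, hSc i, ?_, ?_, ?_, ?_, ?_, ?_, ?_⟩
    · -- (V0) every fibre `S_v` is nonempty
      intro v
      obtain ⟨χ₀, hχ₀⟩ := exists_isVerticialHom h36.isQuasiCoherent h36.isGaloisCountable c v
      obtain ⟨ω, -⟩ := (S i).exists_isVerticialHom_coveringGraph h36 hcoh c (hS i) (cS i) (ω₀ i) (φ i) (hφ i)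
        v χ₀ hχ₀
      exact ⟨⟨v, ω⟩, rfl⟩
    · -- (V1)
      rintro ⟨v, ω⟩
      exact hV1 v ω
    · -- (V2)
      rintro ⟨v, ω⟩ H hH
      exact hV2 v ω H hH
    · -- (V3)
      intro v K hK
      obtain ⟨ω, hω, huniq⟩ := hV3 v hK
      refine ⟨⟨⟨v, ω⟩, hω, ?_⟩, ?_⟩
      · rintro ⟨v', ω'⟩ h'
        obtain rfl : v' = v := hfst hK h'
        rw [huniq ω' h']
      · rintro ⟨v', ω'⟩ h'
        exact hfst hK h'
    · -- (V4)
      rintro v ⟨v', ω'⟩ K K' hK hK' h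
      obtain rfl : v' = v := hfst hK h
      constructor
      · intro h'
        exact hconj hK hK' h h'
      · rintro ⟨n, hn, rfl⟩
        exact hsame n hn h
    · -- (V5) existence and uniqueness of `g · x`
      rintro g ⟨v, ω⟩
      obtain ⟨K₁, hK₁, h₁⟩ := hV1 v ω
      have hgK₁ : K₁.map (MulAut.conj g).toMonoidHom ∈ verticialSubgroups c v := conj_mem_verticialSubgroups c hK₁ g
      obtain ⟨ω₂, hω₂, -⟩ := hV3 v hgK₁
      refine ⟨⟨v, ω₂⟩, ⟨rfl, fun K hK hKx => ?_⟩, ?_⟩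
      · obtain ⟨n, hn, rfl⟩ := hconj hK₁ hK h₁ hKx
        rw [subgroup_map_conj_conj_swap K₁ g n]
        exact hsame (g * n * g⁻¹) ((hnormal i).conj_mem n hn g) hω₂
      · rintro ⟨v', ω'⟩ ⟨hv', hall⟩
        change v' = v at hv'
        subst hv'
        have h' := hall K₁ hK₁ h₁
        exact vertex_eq_of_mem_verticialSubgroups_twice h37S (cS i) h' hω₂
    · -- (V5) transitivity on the fibres
      rintro ⟨v, ω₁⟩ ⟨v', ω₂⟩ hvv
      change v = v' at hvv
      subst hvv
      obtain ⟨K₁, hK₁, h₁⟩ := hV1 v ω₁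
      obtain ⟨K₂, hK₂, h₂⟩ := hV1 v ω₂
      obtain ⟨γ, rfl⟩ := exists_conj_of_mem_verticialSubgroups c hK₁ hK₂
      refine ⟨γ, fun K hK hKx => ?_⟩
      obtain ⟨n, hn, rfl⟩ := hconj hK₁ hK h₁ hKx
      rw [subgroup_map_conj_conj_swap K₁ γ n]
      exact hsame (γ * n * γ⁻¹) ((hnormal i).conj_mem n hn γ) h₂

/-- **The same for a FINITE coherent Thm-3.7 semi-graph of anabelioids with the CANONICAL levels** `N_i :=` the
characteristic open cores of `π₁^temp(𝒢)` (cf. `exists_temperedPi_charOpenCore`): the canonical Ex. 3.10 tower over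
`π₁^temp(𝒢)` comes with the vertex structure (V0)–(V5) of its fibres; in particular its levels are COFINAL among the
open finite-index subgroups. [cite: MochizukiSemiAnbd2006, Ex 3.10 p.44] -/
theorem exists_temperedPi_charOpenCore_vertexFibres [Finite 𝒢.graph.Vertex] [Finite 𝒢.graph.Edge]
    (h37 : 𝒢.Thm37Hypotheses) (hcoh : 𝒢.IsCoherent) :
    ∃ T : SpecialFibreTower (𝒢.temperedPi h37.toProp36Hypotheses),
      T.N = charOpenCore (𝒢.temperedPi h37.toProp36Hypotheses) ∧ (∀ i, T.admKer i = ⊥) ∧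
      (∀ U : Subgroup (𝒢.temperedPi h37.toProp36Hypotheses),
        IsOpen (U : Set (𝒢.temperedPi h37.toProp36Hypotheses)) → U.FiniteIndex → ∃ i, T.N i ≤ U) ∧
      ∀ i, ∃ (S : CovObj 𝒢) (hS : S.IsTempered) (_ : T.Gc i = S.coveringGraph)
        (proj : (T.Gc i).graph.Vertex → 𝒢.graph.Vertex),
        IsConnectedObj (⟨S, hS⟩ : BTempCat 𝒢) ∧
        Function.Surjective proj ∧
        (∀ x, ∃ K ∈ verticialSubgroups (𝒢.temperedPiChart h37.toProp36Hypotheses) (proj x),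
          (K.subgroupOf (T.N i)).map (T.adm i).toMonoidHom ∈ verticialSubgroups (T.chart i) x) ∧
        (∀ x (H : Subgroup (T.chart i).G), H ∈ verticialSubgroups (T.chart i) x →
          ∃ K ∈ verticialSubgroups (𝒢.temperedPiChart h37.toProp36Hypotheses) (proj x),
            H = (K.subgroupOf (T.N i)).map (T.adm i).toMonoidHom) ∧
        (∀ (v : 𝒢.graph.Vertex) (K : Subgroup (𝒢.temperedPi h37.toProp36Hypotheses)),
          K ∈ verticialSubgroups (𝒢.temperedPiChart h37.toProp36Hypotheses) v →
          (∃! x, (K.subgroupOf (T.N i)).map (T.adm i).toMonoidHom ∈ verticialSubgroups (T.chart i) x) ∧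
          ∀ x, (K.subgroupOf (T.N i)).map (T.adm i).toMonoidHom ∈ verticialSubgroups (T.chart i) x →
            proj x = v) ∧
        (∀ (v : 𝒢.graph.Vertex) x (K K' : Subgroup (𝒢.temperedPi h37.toProp36Hypotheses)),
          K ∈ verticialSubgroups (𝒢.temperedPiChart h37.toProp36Hypotheses) v →
          K' ∈ verticialSubgroups (𝒢.temperedPiChart h37.toProp36Hypotheses) v →
          (K.subgroupOf (T.N i)).map (T.adm i).toMonoidHom ∈ verticialSubgroups (T.chart i) x →
          ((K'.subgroupOf (T.N i)).map (T.adm i).toMonoidHom ∈ verticialSubgroups (T.chart i) x ↔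
            ∃ n ∈ T.N i, K' = K.map (MulAut.conj n).toMonoidHom)) ∧
        (∀ (g : 𝒢.temperedPi h37.toProp36Hypotheses) x, ∃! w, proj w = proj x ∧
          ∀ K ∈ verticialSubgroups (𝒢.temperedPiChart h37.toProp36Hypotheses) (proj x),
          (K.subgroupOf (T.N i)).map (T.adm i).toMonoidHom ∈ verticialSubgroups (T.chart i) x →
          ((K.map (MulAut.conj g).toMonoidHom).subgroupOf (T.N i)).map (T.adm i).toMonoidHom ∈
            verticialSubgroups (T.chart i) w) ∧
        (∀ x₁ x₂, proj x₁ = proj x₂ → ∃ g : 𝒢.temperedPi h37.toProp36Hypotheses,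
          ∀ K ∈ verticialSubgroups (𝒢.temperedPiChart h37.toProp36Hypotheses) (proj x₁),
          (K.subgroupOf (T.N i)).map (T.adm i).toMonoidHom ∈ verticialSubgroups (T.chart i) x₁ →
          ((K.map (MulAut.conj g).toMonoidHom).subgroupOf (T.N i)).map (T.adm i).toMonoidHom ∈
            verticialSubgroups (T.chart i) x₂) := by
  have h36 := h37.toProp36Hypotheses
  let c : TemperedPiChart 𝒢 := 𝒢.temperedPiChart h36
  have htfg : Literature.AnabelianGeometry.AbsoluteAnabelian.IsTopologicallyFinitelyGenerated c.G :=
    isTopologicallyFinitelyGenerated_temperedPi_of_coherent h36 hcoh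
  obtain ⟨hanti, hlev, hcof⟩ := charOpenCore_family_of_tfg (Γ := c.G) htfg
  have hchar : ∀ (i) (φ : c.G ≃ₜ* c.G), (charOpenCore c.G i).map φ.toMulEquiv.toMonoidHom = charOpenCore c.G i :=
    fun i φ => (hlev i).2.2.2 φ.toMulEquiv φ.continuous φ.symm.continuous
  obtain ⟨T, hTN, hadm, hfib⟩ := exists_of_coverings_vertexFibres h37
    (isStrictlyCoherent_of_finite ⟨‹_›, ‹_›⟩ hcoh) c (charOpenCore c.G) hanti (fun i => (hlev i).1) hchar
    (fun i => (hlev i).2.1) (fun i => (hlev i).2.2.1) (charOpenCore_exhaustive_of_chart h36 c hcof)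
  refine ⟨T, hTN, hadm, fun U hU hUf => ?_, hfib⟩
  rw [hTN]; exact hcof U hU hUf

end SpecialFibreTower

end Literature.AnabelianGeometry.SemiGraphs

end
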